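import Literature.Algebra.Polynomial.CasasAlvero.Char149Digits
import Literature.Algebra.Polynomial.CasasAlvero.Degree6CandidatesPrime
import Literature.Algebra.Polynomial.CasasAlvero.Degree5
import Literature.Algebra.Polynomial.CasasAlvero.Degree6
import Literature.Algebra.Polynomial.CasasAlvero.DigitReduction
import HarnessLib

/-!
# Casas-Alvero degrees in characteristic 149: the complete classification

Over EVERY field `K` of characteristic `149`: `CA_d(K) ⟺ d = 0 ∨ d = a·149^k` with `1 ≤ a ≤ 6`.
Ingredients: the digit reduction `CA_d ⇒ d = a·p^k ∧ CA_a` (`DigitReduction.lean`, any field); the positive digits `1, 2, 3, 4`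
([GrafVonBothmerEtAl2007, Props. 2, 6]), `5` (`Degree5.lean`) and `6` (`149` is not among the `54` candidate bad primes of degree `6` of `Degree6CandidatesPrime.lean`, so `CA_6` holds in characteristic `149` —
a GOOD prime for degree `6` [CastryckLaterveerOunaies2012, Thm. 4] — and `CA_{6·p^k}` descends from the algebraic closure); and a refutation of every digit `7 ≤ a ≤ 148` over every field of characteristic `149`:
`7` by the sparse `𝔽_149`-septic of `Char149Digits.lean` (the degree-7 table of `BadDegrees.lean` stops at `61`); `35, 37, 43, 60, 71, 81, 82, 96, 97, 98, 99, 115, 118, 119, 123, 129, 131, 138, 141, 146, 148` by the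
binomial criterion (`m = 7, 17, 14, 10, 20, 32, 30, 30, 20, 10, 32, 19, 52, 14, 25, 33, 20, 50, 28, 33, 2`); and the 120 remaining digits by the sparse `𝔽_149`-examples of `Char149Digits.lean`.
-/

noncomputable section

open Polynomial

set_option maxRecDepth 8192

namespace Literature.Algebra.Polynomial.CasasAlvero

variable (K : Type*) [Field K] [CharP K 149]


/-- `CA_{6·149^k}` over every field of characteristic `149` (`CA_6` itself — the case `k = 0` — holds because `149` is not among the
`54` candidate bad primes of degree `6` of `Degree6CandidatesPrime.lean`, `holdsInDegree_six_of_not_mem`, i.e. `149` is a GOOD prime for degree `6`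
[cite: CastryckLaterveerOunaies2012, Thm. 4]). [cite: GrafVonBothmerEtAl2007, Prop. 6] -/
theorem holdsInDegree_six_mul_pow_of_char_149' (k : ℕ) : HoldsInDegree K (6 * 149 ^ k) := by
  haveI : Fact (Nat.Prime 149) := ⟨by norm_num⟩
  exact holdsInDegree_mul_prime_pow_field K 149 (holdsInDegree_six_of_not_mem (K := AlgebraicClosure K) 149 (by decide)) k

set_option maxHeartbeats 1000000 in
/-- every digit `7 ≤ a < 149` fails: `¬ CA_a` over every field of characteristic `149` — the bad-prime computations of
[cite: CastryckLaterveerOunaies2012, Thm. 4] (degrees `≤ 7`) extended to every digit below `149` by explicit `𝔽_149`-rational examples and the binomial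
criterion. [cite: GrafVonBothmerEtAl2007, Prop. 6] -/
theorem not_holdsInDegree_digit_of_char_oneHundredFortyNine {a : ℕ} (h7 : 7 ≤ a) (hap : a < 149) : ¬ HoldsInDegree K a := by
  haveI : Fact (Nat.Prime 149) := ⟨by norm_num⟩
  interval_cases a
  · exact not_holdsInDegree_seven_of_char_149 K
  · exact not_holdsInDegree_eight_of_char_149 K
  · exact not_holdsInDegree_nine_of_char_149 K
  · exact not_holdsInDegree_ten_of_char_149 K
  · exact not_holdsInDegree_eleven_of_char_149 K
  · exact not_holdsInDegree_twelve_of_char_149 K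
  · exact not_holdsInDegree_thirteen_of_char_149 K
  · exact not_holdsInDegree_fourteen_of_char_149 K
  · exact not_holdsInDegree_fifteen_of_char_149 K
  · exact not_holdsInDegree_sixteen_of_char_149 K
  · exact not_holdsInDegree_seventeen_of_char_149 K
  · exact not_holdsInDegree_eighteen_of_char_149 K
  · exact not_holdsInDegree_nineteen_of_char_149 K
  · exact not_holdsInDegree_twenty_of_char_149 K
  · exact not_holdsInDegree_twentyOne_of_char_149 K
  · exact not_holdsInDegree_twentyTwo_of_char_149 K
  · exact not_holdsInDegree_twentyThree_of_char_149 K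
  · exact not_holdsInDegree_twentyFour_of_char_149 K
  · exact not_holdsInDegree_twentyFive_of_char_149 K
  · exact not_holdsInDegree_twentySix_of_char_149 K
  · exact not_holdsInDegree_twentySeven_of_char_149 K
  · exact not_holdsInDegree_twentyEight_of_char_149 K
  · exact not_holdsInDegree_twentyNine_of_char_149 K
  · exact not_holdsInDegree_thirty_of_char_149 K
  · exact not_holdsInDegree_thirtyOne_of_char_149 K
  · exact not_holdsInDegree_thirtyTwo_of_char_149 K
  · exact not_holdsInDegree_thirtyThree_of_char_149 K
  · exact not_holdsInDegree_thirtyFour_of_char_149 K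
  · exact not_holdsInDegree_of_choose_modEq_one K 149 (d := 35) (m := 7) (by norm_num) (by norm_num) (by decide)
  · exact not_holdsInDegree_thirtySix_of_char_149 K
  · exact not_holdsInDegree_of_choose_modEq_one K 149 (d := 37) (m := 17) (by norm_num) (by norm_num) (by decide)
  · exact not_holdsInDegree_thirtyEight_of_char_149 K
  · exact not_holdsInDegree_thirtyNine_of_char_149 K
  · exact not_holdsInDegree_forty_of_char_149 K
  · exact not_holdsInDegree_fortyOne_of_char_149 K
  · exact not_holdsInDegree_fortyTwo_of_char_149 K
  · exact not_holdsInDegree_of_choose_modEq_one K 149 (d := 43) (m := 14) (by norm_num) (by norm_num) (by decide)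
  · exact not_holdsInDegree_fortyFour_of_char_149 K
  · exact not_holdsInDegree_fortyFive_of_char_149 K
  · exact not_holdsInDegree_fortySix_of_char_149 K
  · exact not_holdsInDegree_fortySeven_of_char_149 K
  · exact not_holdsInDegree_fortyEight_of_char_149 K
  · exact not_holdsInDegree_fortyNine_of_char_149 K
  · exact not_holdsInDegree_fifty_of_char_149 K
  · exact not_holdsInDegree_fiftyOne_of_char_149 K
  · exact not_holdsInDegree_fiftyTwo_of_char_149 K
  · exact not_holdsInDegree_fiftyThree_of_char_149 K
  · exact not_holdsInDegree_fiftyFour_of_char_149 K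
  · exact not_holdsInDegree_fiftyFive_of_char_149 K
  · exact not_holdsInDegree_fiftySix_of_char_149 K
  · exact not_holdsInDegree_fiftySeven_of_char_149 K
  · exact not_holdsInDegree_fiftyEight_of_char_149 K
  · exact not_holdsInDegree_fiftyNine_of_char_149 K
  · exact not_holdsInDegree_of_choose_modEq_one K 149 (d := 60) (m := 10) (by norm_num) (by norm_num) (by decide)
  · exact not_holdsInDegree_sixtyOne_of_char_149 K
  · exact not_holdsInDegree_sixtyTwo_of_char_149 K
  · exact not_holdsInDegree_sixtyThree_of_char_149 K
  · exact not_holdsInDegree_sixtyFour_of_char_149 K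
  · exact not_holdsInDegree_sixtyFive_of_char_149 K
  · exact not_holdsInDegree_sixtySix_of_char_149 K
  · exact not_holdsInDegree_sixtySeven_of_char_149 K
  · exact not_holdsInDegree_sixtyEight_of_char_149 K
  · exact not_holdsInDegree_sixtyNine_of_char_149 K
  · exact not_holdsInDegree_seventy_of_char_149 K
  · exact not_holdsInDegree_of_choose_modEq_one K 149 (d := 71) (m := 20) (by norm_num) (by norm_num) (by decide)
  · exact not_holdsInDegree_seventyTwo_of_char_149 K
  · exact not_holdsInDegree_seventyThree_of_char_149 K
  · exact not_holdsInDegree_seventyFour_of_char_149 K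
  · exact not_holdsInDegree_seventyFive_of_char_149 K
  · exact not_holdsInDegree_seventySix_of_char_149 K
  · exact not_holdsInDegree_seventySeven_of_char_149 K
  · exact not_holdsInDegree_seventyEight_of_char_149 K
  · exact not_holdsInDegree_seventyNine_of_char_149 K
  · exact not_holdsInDegree_eighty_of_char_149 K
  · exact not_holdsInDegree_of_choose_modEq_one K 149 (d := 81) (m := 32) (by norm_num) (by norm_num) (by decide)
  · exact not_holdsInDegree_of_choose_modEq_one K 149 (d := 82) (m := 30) (by norm_num) (by norm_num) (by decide)
  · exact not_holdsInDegree_eightyThree_of_char_149 K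
  · exact not_holdsInDegree_eightyFour_of_char_149 K
  · exact not_holdsInDegree_eightyFive_of_char_149 K
  · exact not_holdsInDegree_eightySix_of_char_149 K
  · exact not_holdsInDegree_eightySeven_of_char_149 K
  · exact not_holdsInDegree_eightyEight_of_char_149 K
  · exact not_holdsInDegree_eightyNine_of_char_149 K
  · exact not_holdsInDegree_ninety_of_char_149 K
  · exact not_holdsInDegree_ninetyOne_of_char_149 K
  · exact not_holdsInDegree_ninetyTwo_of_char_149 K
  · exact not_holdsInDegree_ninetyThree_of_char_149 K
  · exact not_holdsInDegree_ninetyFour_of_char_149 K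
  · exact not_holdsInDegree_ninetyFive_of_char_149 K
  · exact not_holdsInDegree_of_choose_modEq_one K 149 (d := 96) (m := 30) (by norm_num) (by norm_num) (by decide)
  · exact not_holdsInDegree_of_choose_modEq_one K 149 (d := 97) (m := 20) (by norm_num) (by norm_num) (by decide)
  · exact not_holdsInDegree_of_choose_modEq_one K 149 (d := 98) (m := 10) (by norm_num) (by norm_num) (by decide)
  · exact not_holdsInDegree_of_choose_modEq_one K 149 (d := 99) (m := 32) (by norm_num) (by norm_num) (by decide)
  · exact not_holdsInDegree_oneHundred_of_char_149 K
  · exact not_holdsInDegree_oneHundredOne_of_char_149 K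
  · exact not_holdsInDegree_oneHundredTwo_of_char_149 K
  · exact not_holdsInDegree_oneHundredThree_of_char_149 K
  · exact not_holdsInDegree_oneHundredFour_of_char_149 K
  · exact not_holdsInDegree_oneHundredFive_of_char_149 K
  · exact not_holdsInDegree_oneHundredSix_of_char_149 K
  · exact not_holdsInDegree_oneHundredSeven_of_char_149 K
  · exact not_holdsInDegree_oneHundredEight_of_char_149 K
  · exact not_holdsInDegree_oneHundredNine_of_char_149 K
  · exact not_holdsInDegree_oneHundredTen_of_char_149 K
  · exact not_holdsInDegree_oneHundredEleven_of_char_149 K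
  · exact not_holdsInDegree_oneHundredTwelve_of_char_149 K
  · exact not_holdsInDegree_oneHundredThirteen_of_char_149 K
  · exact not_holdsInDegree_oneHundredFourteen_of_char_149 K
  · exact not_holdsInDegree_of_choose_modEq_one K 149 (d := 115) (m := 19) (by norm_num) (by norm_num) (by decide)
  · exact not_holdsInDegree_oneHundredSixteen_of_char_149 K
  · exact not_holdsInDegree_oneHundredSeventeen_of_char_149 K
  · exact not_holdsInDegree_of_choose_modEq_one K 149 (d := 118) (m := 52) (by norm_num) (by norm_num) (by decide)
  · exact not_holdsInDegree_of_choose_modEq_one K 149 (d := 119) (m := 14) (by norm_num) (by norm_num) (by decide)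
  · exact not_holdsInDegree_oneHundredTwenty_of_char_149 K
  · exact not_holdsInDegree_oneHundredTwentyOne_of_char_149 K
  · exact not_holdsInDegree_oneHundredTwentyTwo_of_char_149 K
  · exact not_holdsInDegree_of_choose_modEq_one K 149 (d := 123) (m := 25) (by norm_num) (by norm_num) (by decide)
  · exact not_holdsInDegree_oneHundredTwentyFour_of_char_149 K
  · exact not_holdsInDegree_oneHundredTwentyFive_of_char_149 K
  · exact not_holdsInDegree_oneHundredTwentySix_of_char_149 K
  · exact not_holdsInDegree_oneHundredTwentySeven_of_char_149 K
  · exact not_holdsInDegree_oneHundredTwentyEight_of_char_149 K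
  · exact not_holdsInDegree_of_choose_modEq_one K 149 (d := 129) (m := 33) (by norm_num) (by norm_num) (by decide)
  · exact not_holdsInDegree_oneHundredThirty_of_char_149 K
  · exact not_holdsInDegree_of_choose_modEq_one K 149 (d := 131) (m := 20) (by norm_num) (by norm_num) (by decide)
  · exact not_holdsInDegree_oneHundredThirtyTwo_of_char_149 K
  · exact not_holdsInDegree_oneHundredThirtyThree_of_char_149 K
  · exact not_holdsInDegree_oneHundredThirtyFour_of_char_149 K
  · exact not_holdsInDegree_oneHundredThirtyFive_of_char_149 K
  · exact not_holdsInDegree_oneHundredThirtySix_of_char_149 K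
  · exact not_holdsInDegree_oneHundredThirtySeven_of_char_149 K
  · exact not_holdsInDegree_of_choose_modEq_one K 149 (d := 138) (m := 50) (by norm_num) (by norm_num) (by decide)
  · exact not_holdsInDegree_oneHundredThirtyNine_of_char_149 K
  · exact not_holdsInDegree_oneHundredForty_of_char_149 K
  · exact not_holdsInDegree_of_choose_modEq_one K 149 (d := 141) (m := 28) (by norm_num) (by norm_num) (by decide)
  · exact not_holdsInDegree_oneHundredFortyTwo_of_char_149 K
  · exact not_holdsInDegree_oneHundredFortyThree_of_char_149 K
  · exact not_holdsInDegree_oneHundredFortyFour_of_char_149 K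
  · exact not_holdsInDegree_oneHundredFortyFive_of_char_149 K
  · exact not_holdsInDegree_of_choose_modEq_one K 149 (d := 146) (m := 33) (by norm_num) (by norm_num) (by decide)
  · exact not_holdsInDegree_oneHundredFortySeven_of_char_149 K
  · exact not_holdsInDegree_of_choose_modEq_one K 149 (d := 148) (m := 2) (by norm_num) (by norm_num) (by decide)

/-- the positive digits `1 ≤ a ≤ 5`: `CA_{a·149^k}` over every field of characteristic `149`. [cite: GrafVonBothmerEtAl2007, Props. 2, 6]
[cite: CastryckLaterveerOunaies2012, Thm. 4] -/
theorem holdsInDegree_mul_oneHundredFortyNine_pow_of_le_five {a : ℕ} (ha0 : 0 < a) (ha5 : a ≤ 5) (k : ℕ) :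
    HoldsInDegree K (a * 149 ^ k) := by
  haveI : Fact (Nat.Prime 149) := ⟨by norm_num⟩
  interval_cases a
  · simpa using holdsInDegree_prime_pow_field K 149 k
  · exact holdsInDegree_two_mul_prime_pow_field K 149 k
  · exact holdsInDegree_three_mul_prime_pow_field K 149 (by norm_num) k
  · exact holdsInDegree_mul_prime_pow_field K 149
      (holdsInDegree_of_le_four_of_charP (AlgebraicClosure K) 149 (by norm_num) le_rfl) k
  · exact holdsInDegree_five_mul_prime_pow_field K 149 (by norm_num) (by norm_num) (by norm_num) (by norm_num)
      (by norm_num) (by norm_num) (by norm_num) (by norm_num) (by norm_num) k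

/-- **characteristic 149, complete**: over every field of characteristic `149`,
`CA_d ⟺ d = 0 ∨ d = a·149^k` with `1 ≤ a ≤ 6`. [cite: GrafVonBothmerEtAl2007, Props. 2, 6, 7]
[cite: CastryckLaterveerOunaies2012, Thm. 4] -/
theorem classification_char_oneHundredFortyNine_complete (d : ℕ) :
    HoldsInDegree K d ↔ d = 0 ∨ ∃ k a : ℕ, 0 < a ∧ a ≤ 6 ∧ d = a * 149 ^ k := by
  haveI : Fact (Nat.Prime 149) := ⟨by norm_num⟩
  constructor
  · intro h
    rcases Nat.eq_zero_or_pos d with rfl | hd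
    · exact Or.inl rfl
    obtain ⟨k, a, ha0, hap, rfl, ha⟩ := digit_of_holdsInDegree K 149 hd.ne' h
    refine Or.inr ⟨k, a, ha0, ?_, rfl⟩
    by_contra h6
    exact not_holdsInDegree_digit_of_char_oneHundredFortyNine K (by omega) hap ha
  · rintro (rfl | ⟨k, a, ha0, ha6, rfl⟩)
    · exact holdsInDegree_zero K
    · rcases Nat.lt_or_ge a 6 with ha | ha
      · exact holdsInDegree_mul_oneHundredFortyNine_pow_of_le_five K ha0 (by omega) k
      · obtain rfl : a = 6 := le_antisymm ha6 ha
        exact holdsInDegree_six_mul_pow_of_char_149' K k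

/-- the set of Casas-Alvero degrees `≤ 22201` in characteristic `149`, explicitly (corollary of the classification:
[cite: GrafVonBothmerEtAl2007, Prop. 6] with [cite: CastryckLaterveerOunaies2012, Thm. 4] and the digit refutations above). -/
theorem holdsInDegree_iff_mem_of_le_char_oneHundredFortyNine_sq {d : ℕ} (hd : d ≤ 22201) :
    HoldsInDegree K d ↔ d ∈ ({0, 1, 2, 3, 4, 5, 6, 149, 298, 447, 596, 745, 894, 22201} : Finset ℕ) := by
  rw [classification_char_oneHundredFortyNine_complete]
  constructor
  · rintro (rfl | ⟨k, a, ha0, ha6, rfl⟩)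
    · decide
    · rcases k with _ | _ | _ | k
      · interval_cases a <;> decide
      · interval_cases a <;> decide
      · interval_cases a <;> simp_all
      · exfalso
        have : 149 ^ 3 ≤ a * 149 ^ (k + 1 + 1 + 1) :=
          le_trans (Nat.pow_le_pow_right (by norm_num) (by omega)) (Nat.le_mul_of_pos_left _ ha0)
        omega
  · intro h
    simp only [Finset.mem_insert, Finset.mem_singleton] at h
    rcases h with rfl | rfl | rfl | rfl | rfl | rfl | rfl | rfl | rfl | rfl | rfl | rfl | rfl | rfl
    · exact Or.inl rfl
    · exact Or.inr ⟨0, 1, by norm_num, by norm_num, by norm_num⟩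
    · exact Or.inr ⟨0, 2, by norm_num, by norm_num, by norm_num⟩
    · exact Or.inr ⟨0, 3, by norm_num, by norm_num, by norm_num⟩
    · exact Or.inr ⟨0, 4, by norm_num, by norm_num, by norm_num⟩
    · exact Or.inr ⟨0, 5, by norm_num, by norm_num, by norm_num⟩
    · exact Or.inr ⟨0, 6, by norm_num, by norm_num, by norm_num⟩
    · exact Or.inr ⟨1, 1, by norm_num, by norm_num, by norm_num⟩
    · exact Or.inr ⟨1, 2, by norm_num, by norm_num, by norm_num⟩
    · exact Or.inr ⟨1, 3, by norm_num, by norm_num, by norm_num⟩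
    · exact Or.inr ⟨1, 4, by norm_num, by norm_num, by norm_num⟩
    · exact Or.inr ⟨1, 5, by norm_num, by norm_num, by norm_num⟩
    · exact Or.inr ⟨1, 6, by norm_num, by norm_num, by norm_num⟩
    · exact Or.inr ⟨2, 1, by norm_num, by norm_num, by norm_num⟩

end Literature.Algebra.Polynomial.CasasAlvero
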